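import Literature.NumberTheory.GaloisRepresentations.LubinTateColemanTwoVariableLimitTwo
import HarnessLib

/-!
# The `Γ_F`-action on the norm-coherent units of the two-variable local tower: baseNorm-coherence and principality are preserved
# (so `σ̃ ↦ (β_m ↦ σ̃·β_m)` acts on `𝒰¹_∞` of the limit sequence (17), with coordinates transformed by `relUnitCoordTwo_galAct_eq`)

De Shalit, *Iwasawa theory of elliptic curves with complex multiplication* (1987), Ch. I §3.4 Lemma (ii), §3.8 (14)–(16): the map `i` is a
homomorphism of `𝒢`-modules and the vertical arrows of (16) are `𝒢`-equivariant, so the limit (17) is a sequence of `Λ(𝒢_a)`-modules.  In the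
tree's series currency the levelwise statements exist (`RelNormCoherentUnits.galAct`, `baseNorm_galAct`, `relUnitCoordTwo_galAct_eq`); this
short file records the two facts needed to let `Γ_F` act on the FAMILIES of `LubinTateColemanTwoVariableLimitTwo`:

* `RelNormCoherentUnits.norm_val_zero_galAct_sub_one` — `σ̃` preserves principal units (`σ̃` is an isometry);
* `galAct_baseNormCoherent` — `σ̃` preserves baseNorm-coherence of a family `(β_m)_m`;
* `principal_of_diagonal_principal` — a baseNorm-coherent family whose DIAGONAL `(β_n)_n ∈ U(E_n·K_π^{n+1})` consists of principal units is
  principal (`(β_m)_0 = N((β_m)_m)`), the hypothesis under which the limit sequence applies to Rubin's `U_∞ = lim← U¹(F_n)`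
  (`existsUnique_baseNormCoherent_of_diagonal`).

Everything PROVED (0 sorry, no named facts, no new definitions).

## References

* E. de Shalit, *Iwasawa theory of elliptic curves with complex multiplication* (1987), Ch. I §3.4 Lemma (ii), §3.8 (14)–(17). [deShalit1987]
-/

noncomputable section

namespace Literature.NumberTheory.GaloisRepresentations

section TwoVariableGaloisTwo

open GaloisRepresentations.IsNonarchimedeanLocalField LubinTate ValuativeRel Field

variable {F : Type} [Field F] [ValuativeRel F] [TopologicalSpace F] [IsNonarchimedeanLocalField F]

attribute [local instance] ltNormUniformSpace ltNormIsUniformAddGroup rk1 nF nE fintypeResidueField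

variable {π : 𝒪[F]} (hπ : (valuation F).IsUniformizer (π : F))

/-! ### `Γ_F` preserves principal units -/

/-- **`σ̃ ∈ Γ_F` preserves principal norm-coherent units**: `‖(σ̃·β)_0 − 1‖ = ‖β_0 − 1‖` (`σ̃` acts isometrically on `E·K_π^1`).
[cite: deShalit1987, Ch. I §3.4 Lemma (ii)] -/
theorem RelNormCoherentUnits.norm_val_zero_galAct_sub_one {E : IntermediateField F (AlgebraicClosure F)} [FiniteDimensional F E] [Normal F E]
    (σ : absoluteGaloisGroup F) (β : RelNormCoherentUnits hπ E) :
    ‖(((β.galAct σ).val 0 : unitBall (E ⊔ ltField π 0 : IntermediateField F (AlgebraicClosure F))) :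
        (E ⊔ ltField π 0 : IntermediateField F (AlgebraicClosure F))) - 1‖ =
      ‖((β.val 0 : unitBall (E ⊔ ltField π 0 : IntermediateField F (AlgebraicClosure F))) :
        (E ⊔ ltField π 0 : IntermediateField F (AlgebraicClosure F))) - 1‖ := by
  have e : relRestrict hπ E 0 σ ((β.val 0 : unitBall (E ⊔ ltField π 0 : IntermediateField F (AlgebraicClosure F))) :
      (E ⊔ ltField π 0 : IntermediateField F (AlgebraicClosure F))) - 1 =
      relRestrict hπ E 0 σ (((β.val 0 : unitBall (E ⊔ ltField π 0 : IntermediateField F (AlgebraicClosure F))) :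
        (E ⊔ ltField π 0 : IntermediateField F (AlgebraicClosure F))) - 1) := by
    rw [map_sub, map_one]
  rw [RelNormCoherentUnits.coe_val_galAct, e, norm_algEquiv]

/-! ### `Γ_F` acts on baseNorm-coherent families -/

variable (E : ℕ → IntermediateField F (AlgebraicClosure F)) [∀ m, FiniteDimensional F (E m)] [∀ m, Normal F (E m)]
  [∀ m, IsGalois F (E m)] (hmono : Monotone E)

/-- **`σ̃ ∈ Γ_F` preserves baseNorm-coherence**: if `N_{E_{m+1}/E_m} β_{m+1} = β_m` for all `m` then the same holds for `(σ̃·β_m)_m`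
(`baseNorm_galAct`). [cite: deShalit1987, Ch. I §3.8 (16)] -/
theorem galAct_baseNormCoherent (σ : absoluteGaloisGroup F) {β : ∀ m, RelNormCoherentUnits hπ (E m)}
    (hβ : ∀ m, (β (m + 1)).baseNorm hπ (hmono (Nat.le_succ m)) = β m) (m : ℕ) :
    ((β (m + 1)).galAct σ).baseNorm hπ (hmono (Nat.le_succ m)) = (β m).galAct σ := by
  rw [RelNormCoherentUnits.baseNorm_galAct, hβ]

omit [∀ m, IsGalois F (E m)] in
/-- **`σ̃ ∈ Γ_F` preserves principality of a family.** [cite: deShalit1987, Ch. I §3.4 Lemma (ii)] -/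
theorem galAct_principal (σ : absoluteGaloisGroup F) {β : ∀ m, RelNormCoherentUnits hπ (E m)}
    (hβ1 : ∀ m, ‖(((β m).val 0 : unitBall (E m ⊔ ltField π 0 : IntermediateField F (AlgebraicClosure F))) :
      (E m ⊔ ltField π 0 : IntermediateField F (AlgebraicClosure F))) - 1‖ < 1) (m : ℕ) :
    ‖((((β m).galAct σ).val 0 : unitBall (E m ⊔ ltField π 0 : IntermediateField F (AlgebraicClosure F))) :
      (E m ⊔ ltField π 0 : IntermediateField F (AlgebraicClosure F))) - 1‖ < 1 := by
  rw [RelNormCoherentUnits.norm_val_zero_galAct_sub_one]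
  exact hβ1 m

/-! ### Principality is read on the diagonal -/

omit [∀ m, Normal F (E m)] in
/-- **A family whose diagonal consists of principal units is principal**: `(β_m)_0 = N_{E_m·K_π^{m+1}/E_m·K_π^1}((β_m)_m)` and norms of principal
units are principal.  So Rubin's `U_∞ = lim← U¹(F_n)` (principal units along one cofinal chain) lands in the principal families of the limit
sequence. [cite: deShalit1987, Ch. I §3.8 (17)] -/
theorem principal_of_diagonal_principal {β : ∀ m, RelNormCoherentUnits hπ (E m)}
    (hdiag : ∀ n, ‖(((β n).val n : unitBall (E n ⊔ ltField π n : IntermediateField F (AlgebraicClosure F))) :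
      (E n ⊔ ltField π n : IntermediateField F (AlgebraicClosure F))) - 1‖ < 1) (m : ℕ) :
    ‖(((β m).val 0 : unitBall (E m ⊔ ltField π 0 : IntermediateField F (AlgebraicClosure F))) :
      (E m ⊔ ltField π 0 : IntermediateField F (AlgebraicClosure F))) - 1‖ < 1 := by
  haveI := isGalois_sup_ltField hπ (E m) m
  rw [← (β m).coherent 0 m (Nat.zero_le m)]
  exact norm_towerNorm_sub_one_lt_one _ ((mem_unitBall_iff _).mp ((β m).val m).2) (hdiag m)

end TwoVariableGaloisTwo

end Literature.NumberTheory.GaloisRepresentations
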